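import Literature.MathematicalPhysics.QuantumFieldTheory.Balaban1983to89.B7Prop5Cplx
import Literature.MathematicalPhysics.QuantumFieldTheory.Balaban1983to89.B7Prop5GeneralOperator

/-!
# `Balaban1983to89.B7Prop5CplxOperator` — T. Bałaban, *Averaging operations for lattice gauge theories*, Commun. Math. Phys. **98**
(1985) 17–51 [Balaban1985Averaging]: **PROPOSITION 5 (156) AT THE COMPLEX BACKGROUND `U′U₀` IN OPERATOR FORM, UNIFORMLY IN `U′`** —
Proposition 7's «Similarly, Proposition 5 may be extended to include analyticity and uniformity statements» (p. 43) in the shape the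
consumers use: the composite averaging `Q_j(U′U₀, ·)` as a Fréchet-differentiable map between FINITE sup-normed products of bond
variables, its partial derivatives identified with the single-bond differentials (137) of `B7Prop5Cplx`, and the sup → sup bound
`‖D Q_j(U′U₀, ·)‖ ≤ 2dLʲ(1 + ϑLʲ/Lᵏ + C₃Lʲρ)` with `ϑ`, `C₃` INDEPENDENT OF `U′`, k-uniform, PROVED — the `U′U₀` twin of
`B7Prop5GeneralOperator` (gen 3) / `B7Prop5FlatOperator` (r20)

statement-level skeleton of published theorems with citation tags; proofs where landed; nothing here is a claim about the Yang–Mills mass gap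

PDF held: `paper:balaban1985-cmp98-averaging` (journal page = PDF page + 16); pp. 38–43 [PDF 22–27] read from the materialised text
layer `~/.lit/texts/paper-balaban1985-cmp98-averaging/p0022.txt`–`p0027.txt`.

CITATION HEADER / WHAT IS REPRODUCED.  SKELETON row **B7.Prop7** — cell `lit-balaban`, seat p06 gen 4 = unit `lit-balaban-p06`; owner
r04, referee ref-4.  p. 43, verbatim: *"Proposition 7. For U₀ satisfying (52) and U′ = e^{iηA′}, |A′| < α₁, α₀, α₁ sufficiently small,
the function Q_k(U′U₀, ηA) is analytic in complex variables A′, A, and Proposition 4 holds uniformly in A′. Similarly, Proposition 5 may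
be extended to include analyticity and uniformity statements. The formulations are obvious."*; p. 42 (156): *"|(δ/δA_b)Q_k(U₀, ηA, c)| ≦
1 + 2C′₁α₀ + C₃|A|"*; p. 39 (138): *"the functional derivative coincides with partial derivatives (gradient) of F(A) multiplied by
η^{−d}"*, (141): *"(Q″_kA)_c = Σ_{b⊂B^k(c₋)∪B^k(c₊)} η^dA_b"*.  `B7Prop5Cplx.prop5_cplx_156_uniform` (this seat, file 5) is (156) at
`U′U₀` PER BOND; THIS FILE is its operator form on `𝔸^S → 𝔸^T`, obtained exactly as `B7Prop5GeneralOperator` obtains the operator form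
of `B7Prop5General.prop5_general_156`: (138) summed over the bonds of (141), row by row, with the per-bond sizes of
`prop5_cplx_156_uniform`/`prop5_cplx_157_uniform`/`prop5_cplx_147_uniform` and the count `Σ_s kerQdd(c, s) ≤ 2d` of
`B7Ineq149Pairing.sum_kerQdd_mul_norm_le`; the analyticity clause is Prop. 7's (`B7Prop7Levels.prop7_analyticAt`, r04, BY NAME).

DICTIONARY (as in `B7Prop5GeneralOperator` with the background `U′U₀ = expCfg B′ * U₀`, `‖B′‖ ≤ b′`): `S` = a finite set of fine bonds
(the variables, `B7Prop3Flat.insCfg`), `T` = a finite set of bonds of the `j`-th lattice; the map is gen 3's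
**`B7Prop5GeneralOperator.covAvgMap L (expCfg B′ * U₀) S T j a c = logCovIter L (e^{B′}U₀) (insCfg S a) j c`** = `Q_j(U′U₀, B)(c)`
(no new definition); `ϑ = thetaCplx d L α₀ k b′` (print's `2C′₁α₀` at `U′U₀`), `C₃ = C3Cplx d L`; the per-bond size (156) at `U′U₀` in
`B`-variables = `((1 + ϑLʲ/Lᵏ)·Lʲ + C₃(Lʲ)²ρ)·L^{−jd}`; regime = that of `B7Prop5Cplx` §2 (background smallness `hsmall′`, `hc₃′`,
`hb′1`, `hE`, `hdX` at `b′`; field radius `ρ > 0` with `hsmall`, `16Lᵏρ < c₃`, `d·C₃·Lᵏρ ≤ 1`), on the closed polydisc `‖a_s‖ ≤ ρ`.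

WHAT THIS FILE PROVES (kernel, 0 sorry, standard axioms; theorems only), for every `j ≤ k`:
* §1 `analyticAt_covAvgMap_cplx_apply`, `differentiableAt_covAvgMap_cplx` — Prop. 7's analyticity at `U′U₀` transported to `𝔸^S`.
* §2 **`fderiv_covAvgMap_cplx_single`**: `∂_s Q_j(U′U₀, ·)(c)·X = dC_j(U′U₀, B; X·δ_s)(c) + LʲηQ_j(U′U₀)(X·δ_s)(c)`;
  **`norm_fderiv_covAvgMap_cplx_single_le`**: `≤ ((1 + ϑLʲ/Lᵏ)Lʲ + C₃(Lʲ)²ρ)·kerQdd(c, s)·‖X‖`; `fderiv_covAvgMap_cplx_single_eq_zero`.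
* §3 **`opNorm_fderiv_covAvgMap_cplx_le`**: `‖D Q_j(U′U₀, ·)(B)‖_{sup→sup} ≤ 2dLʲ(1 + ϑLʲ/Lᵏ + C₃Lʲρ)`, and the real-scalar forms
  `differentiableAt_covAvgMap_cplx_real`, `fderiv_real_covAvgMap_cplx_apply`, **`opNorm_fderiv_real_covAvgMap_cplx_le`**,
  `fderiv_real_covAvgMap_cplx_single_bound` — all constants independent of `U′`.

DIVERGENCES / NOT PROVED.  As `B7Prop5Cplx` / `B7Prop5GeneralOperator` (explicit, non-optimal `ϑ`, `C₃`; `ℤᵈ`, corner blocks;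
`U1`/`AvgClosed`; bound in `B`-variables; the count `2d·L^{jd}`; print states (156) per bond, not an operator norm).
-/

open scoped BigOperators
open NormedSpace Finset Metric

namespace Literature.MathematicalPhysics.QuantumFieldTheory.Balaban1983to89.B7Prop5CplxOperator

open B7Prop1Explicit B7Prop1Local B7Prop2Explicit B7Prop3Flat B7Prop4Flat B7Eq92Concrete B7Prop3GeneralLinear
  B7Prop4GeneralLevels B7Ineq148 B7Prop5GeneralOperators B7Prop5GeneralInduction B7Prop5CplxLevels B7Prop5Cplx B7Prop7Levels
  B7Prop5GeneralOperator
open B7Prop5Flat (BondIn bump)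
open B7Prop5FlatOperator (insCfg_line norm_insCfg_le_of_le)
open B7Ineq149Pairing (sum_kerQdd_mul_norm_le)

-- `Site` alone would resolve to the torus sites of `Setup.lean`; re-export the `ℤ^d` sites of `B7Prop1Explicit`.
export B7Prop1Explicit (Site)

variable {d : ℕ}

section Regime

variable {𝔸 : Type*} [NormedRing 𝔸] [NormedAlgebra ℂ 𝔸] [CompleteSpace 𝔸] [NormOneClass 𝔸]

variable (L : ℕ) (hL : 2 ≤ L) {G : Subgroup 𝔸ˣ} (hG : AvgClosed d L G) (k : ℕ)
  (U₀ : Site d → Fin d → 𝔸ˣ) (hU₀ : ∀ x κ, U₀ x κ ∈ G) {α₀ : ℝ} (hα : 0 < α₀)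
  (hα3 : C0 d * α₀ ≤ 1 / 3) (hα8 : 8 * α₀ ≤ c2' d L) (h52 : pdev U₀ < α₀ * (((L : ℝ) ^ k)⁻¹) ^ 2)
  (B' : Site d → Fin d → 𝔸) {b' : ℝ} (hb' : 0 ≤ b') (hB' : ∀ x κ, ‖B' x κ‖ ≤ b')
  (hsmall' : Real.exp (4 * (800 * ((d : ℝ) + 1) ^ 2 * ((d : ℝ) + 4)) * α₀)
    * (1 + 8 * (131072 * ((d : ℝ) + 1) ^ 2) * ((L : ℝ) ^ k * b')) ≤ 2)
  (hc₃' : 2 * ((L : ℝ) ^ k * b') ≤ c3 d L) (hb'1 : 409600 * ((d : ℝ) + 1) ^ 2 * ((L : ℝ) ^ k * b') ≤ 1)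
  (hE : epsCplx d L b' k ≤ 1 / 16) (hdX : (d : ℝ) * (epsCplx d L b' k + tauCplx d L α₀ k b' k) ≤ 1 / 16)
  {ρ : ℝ} (hρ : 0 < ρ)
  (hsmall : Real.exp (4480 * ((d : ℝ) + 1) ^ 2 * ((d : ℝ) + 4) * α₀ + 240000 * ((d : ℝ) + 1) ^ 3 * ((L : ℝ) ^ k * b'))
    * (1 + 8 * (2097152 * ((d : ℝ) + 1) ^ 2) * ((L : ℝ) ^ k * ρ)) ≤ 2)
  (hc₃ : 16 * ((L : ℝ) ^ k * ρ) < c3 d L) (hβ : (d : ℝ) * C3Cplx d L * ((L : ℝ) ^ k * ρ) ≤ 1)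
  (S T : Finset (Site d × Fin d)) {a : S → 𝔸} (ha : ∀ s, ‖a s‖ ≤ ρ)

/-! ## §1 Analyticity and differentiability (Prop. 7's analyticity at `U′U₀`, BY NAME) -/

include hL hG hU₀ hα hα3 hα8 h52 hb' hB' hsmall' hc₃' hb'1 hρ hsmall hc₃ ha in
/-- **Prop. 7's analyticity clause at the complex background, transported**: under `sup_s ‖a_s‖ ≤ ρ` and the regime, every component
`a′ ↦ Q_j(U′U₀, ins a′)(c)` of `covAvgMap L (e^{B′}U₀) S T j`, `j ≤ k`, is analytic at `a` (`B7Prop7Levels.prop7_analyticAt` with the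
constant background family `B′` and the bondwise analytic parametrisation `insCfg`). [cite: Balaban1985Averaging, Proposition 7 p.43] -/
theorem analyticAt_covAvgMap_cplx_apply {j : ℕ} (hj : j ≤ k) (c : T) :
    AnalyticAt ℂ (fun a' : S → 𝔸 => covAvgMap L (expCfg B' * U₀) S T j a' c) a := by
  have hLkρ : 0 ≤ (L : ℝ) ^ k * ρ := by positivity
  have hc₃4 : 2 * ((L : ℝ) ^ k * ρ) ≤ c3 d L / 4 := by linarith
  exact prop7_analyticAt L hL hG k U₀ hU₀ hα hα3 hα8 h52 (fun _ : S → 𝔸 => B') (fun x κ' => analyticAt_const) hb' hB' hsmall'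
    hc₃' hb'1 (fun a' : S → 𝔸 => insCfg S a') (fun x κ' => analyticAt_insCfg S x κ' a) hρ.le
    (fun x κ' => norm_insCfg_le_of_le hρ.le ha x κ') hsmall hc₃4 j hj c.1.1 c.1.2

include hL hG hU₀ hα hα3 hα8 h52 hb' hB' hsmall' hc₃' hb'1 hρ hsmall hc₃ ha in
/-- `covAvgMap L (e^{B′}U₀) S T j` is (complex) Fréchet differentiable at every point of the closed polydisc `sup_s ‖a_s‖ ≤ ρ`, `j ≤ k`.
[cite: Balaban1985Averaging, Proposition 7 p.43, (137)–(138) p.39] -/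
theorem differentiableAt_covAvgMap_cplx {j : ℕ} (hj : j ≤ k) : DifferentiableAt ℂ (covAvgMap L (expCfg B' * U₀) S T j) a :=
  differentiableAt_pi.2 fun c =>
    (analyticAt_covAvgMap_cplx_apply L hL hG k U₀ hU₀ hα hα3 hα8 h52 B' hb' hB' hsmall' hc₃' hb'1 hρ hsmall hc₃ S T ha hj
      c).differentiableAt

/-! ## §2 The partial derivatives are the single-bond differentials of `B7Prop5Cplx`: (156) at `U′U₀` per bond, and locality -/

include hL hG hU₀ hα hα3 hα8 h52 hb' hB' hsmall' hc₃' hb'1 hE hdX hρ hsmall hc₃ hβ ha in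
/-- **`∂_s Q_j(U′U₀, ·)(c)·X = dC_j(U′U₀, B; X·δ_s)(c) + LʲηQ_j(U′U₀)(X·δ_s)(c)`**: the Fréchet partial derivative of
`covAvgMap L (e^{B′}U₀) S T j` in the variable `s` applied to `X` is the single-bond differential (137) of `Q_j(U′U₀, ·)(c) = C_j +
LʲηQ_j(U′U₀)` at `B = ins a` in the direction `bump s X` (`prop5_cplx_156_uniform`: the line derivative; uniqueness of the derivative
along the inserted complex line `ins(a + tX·δ_s) = B + t·bump_s X`). [cite: Balaban1985Averaging, (137)–(138) p.39, (156) p.42, Proposition 7 p.43] -/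
theorem fderiv_covAvgMap_cplx_single {j : ℕ} (hj : j ≤ k) (s : S) (X : 𝔸) (c : T) :
    fderiv ℂ (covAvgMap L (expCfg B' * U₀) S T j) a (Pi.single s X) c =
      dCov L (expCfg B' * U₀) (insCfg S a) (bump s.1.1 s.1.2 X) j c.1.1 c.1.2
        + linCovIter L (expCfg B' * U₀) (bump s.1.1 s.1.2 X) j c.1.1 c.1.2 := by
  have hD := differentiableAt_covAvgMap_cplx L hL hG k U₀ hU₀ hα hα3 hα8 h52 B' hb' hB' hsmall' hc₃' hb'1 hρ hsmall hc₃ S T ha hj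
  have hB : ∀ x κ', ‖insCfg S a x κ'‖ ≤ ρ := fun x κ' => norm_insCfg_le_of_le hρ.le ha x κ'
  -- the derivative of `covAvgMap` along the line `a + t·X·δ_s`, component `c`
  have hline : HasDerivAt (fun t : ℂ => a + t • (Pi.single s X : S → 𝔸)) (Pi.single s X) 0 := by
    simpa using ((hasDerivAt_id (0 : ℂ)).smul_const (Pi.single s X : S → 𝔸)).const_add a
  have hD' : HasFDerivAt (covAvgMap L (expCfg B' * U₀) S T j) (fderiv ℂ (covAvgMap L (expCfg B' * U₀) S T j) a)
      (a + (0 : ℂ) • (Pi.single s X : S → 𝔸)) := by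
    rw [zero_smul, add_zero]; exact hD.hasFDerivAt
  have h1 : HasDerivAt (fun t : ℂ => covAvgMap L (expCfg B' * U₀) S T j (a + t • (Pi.single s X : S → 𝔸)))
      (fderiv ℂ (covAvgMap L (expCfg B' * U₀) S T j) a (Pi.single s X)) 0 := by
    have h := hD'.comp_hasDerivAt (0 : ℂ) hline
    simpa only [Function.comp_def] using h
  have h1c : HasDerivAt (fun t : ℂ => covAvgMap L (expCfg B' * U₀) S T j (a + t • (Pi.single s X : S → 𝔸)) c)
      (fderiv ℂ (covAvgMap L (expCfg B' * U₀) S T j) a (Pi.single s X) c) 0 := (hasDerivAt_pi.1 h1) c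
  -- the single-bond line derivative of `Q_j(U′U₀, ·)(c)` at `B = ins a` in the direction `bump s X` (`prop5_cplx_156_uniform`)
  obtain ⟨h2, -⟩ := prop5_cplx_156_uniform L hL hG k U₀ hU₀ hα hα3 hα8 h52 B' hb' hB' hsmall' hc₃' hb'1 hE hdX (insCfg S a)
    hρ.le hB hsmall hc₃ hβ s.1.1 s.1.2 X hj c.1.1 c.1.2
  have h2' : HasDerivAt (fun t : ℂ => logCovIter L (expCfg B' * U₀) (insCfg S a + t • bump s.1.1 s.1.2 X) j c.1.1 c.1.2)
      (dCov L (expCfg B' * U₀) (insCfg S a) (bump s.1.1 s.1.2 X) j c.1.1 c.1.2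
        + linCovIter L (expCfg B' * U₀) (bump s.1.1 s.1.2 X) j c.1.1 c.1.2) 0 := h2
  have h2'' : HasDerivAt (fun t : ℂ => covAvgMap L (expCfg B' * U₀) S T j (a + t • (Pi.single s X : S → 𝔸)) c)
      (dCov L (expCfg B' * U₀) (insCfg S a) (bump s.1.1 s.1.2 X) j c.1.1 c.1.2
        + linCovIter L (expCfg B' * U₀) (bump s.1.1 s.1.2 X) j c.1.1 c.1.2) 0 := by
    refine h2'.congr_of_eventuallyEq (Filter.Eventually.of_forall fun t => ?_)
    simp only [covAvgMap_apply, insCfg_line]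
  exact h1c.unique h2''

include hL hG hU₀ hα hα3 hα8 h52 hb' hB' hsmall' hc₃' hb'1 hE hdX hρ hsmall hc₃ hβ ha in
/-- **(156) AT `U′U₀`, PER BOND, WITH LOCALITY, for the partial derivatives of `covAvgMap L (e^{B′}U₀) S T j`**: `‖∂_s Q_j(U′U₀,
·)(c)·X‖ ≤ ((1 + ϑLʲ/Lᵏ)·Lʲ + C₃(Lʲ)²ρ)·kerQdd(c, s)·‖X‖` — «|(δ/δA_b)Q_k(U₀, ηA, c)| ≦ 1 + 2C′₁α₀ + C₃|A|» read at `U′U₀` times the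
`η^d` of (138) and the `Lʲ` of the `B`-variables on the box `s ⊂ Bʲ(c₋) ∪ Bʲ(c₊)` (`kerQdd(c, s) = L^{−jd}`), and `0` off the box
(`prop5_cplx_157_uniform`, `prop5_cplx_147_uniform`); `ϑ`, `C₃` independent of `U′`.
[cite: Balaban1985Averaging, Prop. 5 (156) p.42, (138) p.39, (141) p.39, Proposition 7 p.43] -/
theorem norm_fderiv_covAvgMap_cplx_single_le {j : ℕ} (hj : j ≤ k) (s : S) (X : 𝔸) (c : T) :
    ‖fderiv ℂ (covAvgMap L (expCfg B' * U₀) S T j) a (Pi.single s X) c‖ ≤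
      ((1 + thetaCplx d L α₀ k b' * ((L : ℝ) ^ j * ((L : ℝ) ^ k)⁻¹)) * (L : ℝ) ^ j + C3Cplx d L * ((L : ℝ) ^ j) ^ 2 * ρ)
        * kerQdd L j c.1.1 c.1.2 s.1.1 s.1.2 * ‖X‖ := by
  have hB : ∀ x κ', ‖insCfg S a x κ'‖ ≤ ρ := fun x κ' => norm_insCfg_le_of_le hρ.le ha x κ'
  rw [fderiv_covAvgMap_cplx_single L hL hG k U₀ hU₀ hα hα3 hα8 h52 B' hb' hB' hsmall' hc₃' hb'1 hE hdX hρ hsmall hc₃ hβ S T ha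
    hj s X c]
  obtain ⟨-, hC, hCloc⟩ := prop5_cplx_157_uniform L hL hG k U₀ hU₀ hα hα3 hα8 h52 B' hb' hB' hsmall' hc₃' hb'1 hE hdX
    (insCfg S a) hρ.le hB hsmall hc₃ hβ s.1.1 s.1.2 X hj c.1.1 c.1.2
  obtain ⟨hQ, hQloc⟩ := prop5_cplx_147_uniform L hL hG k U₀ hU₀ hα hα3 hα8 h52 B' hb' hB' hsmall' hc₃' hb'1 hE hdX s.1.1 s.1.2
    X hj c.1.1 c.1.2
  by_cases hin : BondIn (loK L j c.1.1) (bondHiK L j c.1.1 c.1.2) s.1.1 s.1.2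
  · rw [kerQdd_of_bondIn hin]
    refine (norm_add_le _ _).trans ?_
    have hsum := add_le_add hC hQ
    refine hsum.trans (le_of_eq ?_)
    ring
  · rw [hCloc hin, hQloc hin, add_zero, norm_zero, kerQdd_of_not_bondIn hin, mul_zero, zero_mul]

include hL hG hU₀ hα hα3 hα8 h52 hb' hB' hsmall' hc₃' hb'1 hE hdX hρ hsmall hc₃ hβ ha in
/-- **LOCALITY of the partial derivatives at `U′U₀`** ((141); Prop. 4/7: `Q_k(U′U₀, ηA, c)` depends on the variables `A_b, b ⊂
B^k(c₋)∪B^k(c₊)` only): `∂_s Q_j(U′U₀, ·)(c) = 0` unless the bond `s` lies in the box `[loK L j z, bondHiK L j z κ]` of `c = (z, κ)`.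
[cite: Balaban1985Averaging, Prop. 4 p.38, (141) p.39, (157) p.42, Proposition 7 p.43] -/
theorem fderiv_covAvgMap_cplx_single_eq_zero {j : ℕ} (hj : j ≤ k) (s : S) (X : 𝔸) (c : T)
    (hnot : ¬ BondIn (loK L j c.1.1) (bondHiK L j c.1.1 c.1.2) s.1.1 s.1.2) :
    fderiv ℂ (covAvgMap L (expCfg B' * U₀) S T j) a (Pi.single s X) c = 0 := by
  have h := norm_fderiv_covAvgMap_cplx_single_le L hL hG k U₀ hU₀ hα hα3 hα8 h52 B' hb' hB' hsmall' hc₃' hb'1 hE hdX hρ hsmall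
    hc₃ hβ S T ha hj s X c
  rw [kerQdd_of_not_bondIn hnot, mul_zero, zero_mul] at h
  exact norm_le_zero_iff.1 h

/-! ## §3 The sup → sup operator bound on `D Q_j(U′U₀, ·)` (Proposition 5 at `U′U₀`, operator form, uniformly in `U′`) -/

include hL hG hU₀ hα hα3 hα8 h52 hb' hB' hsmall' hc₃' hb'1 hE hdX hρ hsmall hc₃ hβ ha in
/-- **PROPOSITION 5 AT THE COMPLEX BACKGROUND `U′U₀`, OPERATOR FORM, k-UNIFORM, UNIFORMLY IN `U′`**: on the finite products `𝔸^S → 𝔸^T`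
(sup norms), for every `j ≤ k` and `sup_s ‖a_s‖ ≤ ρ` in the regime, the Fréchet derivative of `B ↦ Q_j(U′U₀, B)` at `B = ins a` has
operator norm `≤ 2dLʲ(1 + ϑLʲ/Lᵏ + C₃Lʲρ)` — the per-bond bound (156) at `U′U₀` summed over the `≤ 2d·L^{jd}` bonds of `Bʲ(c₋) ∪ Bʲ(c₊)`
with the weight `η^d = L^{−jd}` of (138)/(141), row by row (`B7Ineq149Pairing.sum_kerQdd_mul_norm_le`); `ϑ = thetaCplx d L α₀ k b′`,
`C₃ = C3Cplx d L` do not depend on `U′` («Proposition 5 may be extended to include … uniformity statements»); at a unitary background: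
`B7Prop5GeneralOperator.opNorm_fderiv_covAvgMap_le`. [cite: Balaban1985Averaging, Prop. 5 (156) p.42, (138) p.39, (141) p.39, Proposition 7 p.43] -/
theorem opNorm_fderiv_covAvgMap_cplx_le {j : ℕ} (hj : j ≤ k) :
    ‖fderiv ℂ (covAvgMap L (expCfg B' * U₀) S T j) a‖ ≤
      2 * d * (L : ℝ) ^ j
        * (1 + thetaCplx d L α₀ k b' * ((L : ℝ) ^ j * ((L : ℝ) ^ k)⁻¹) + C3Cplx d L * ((L : ℝ) ^ j * ρ)) := by
  classical
  have hL1 : 1 ≤ L := le_trans (by norm_num) hL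
  have hθ := thetaCplx_nonneg d L hα.le k hb'
  have hC := (C3Cplx_pos d hL1).le
  set f := fderiv ℂ (covAvgMap L (expCfg B' * U₀) S T j) a with hf
  set m : ℝ := (1 + thetaCplx d L α₀ k b' * ((L : ℝ) ^ j * ((L : ℝ) ^ k)⁻¹)) * (L : ℝ) ^ j
    + C3Cplx d L * ((L : ℝ) ^ j) ^ 2 * ρ with hm
  have hm0 : 0 ≤ m := by positivity
  have hK0 : 0 ≤ 2 * d * (L : ℝ) ^ j
      * (1 + thetaCplx d L α₀ k b' * ((L : ℝ) ^ j * ((L : ℝ) ^ k)⁻¹) + C3Cplx d L * ((L : ℝ) ^ j * ρ)) := by positivity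
  refine ContinuousLinearMap.opNorm_le_bound f hK0 fun v => ?_
  refine (pi_norm_le_iff_of_nonneg (by positivity)).mpr fun c => ?_
  have hdec : f v = ∑ s, f (Pi.single s (v s)) := by
    conv_lhs => rw [← Finset.univ_sum_single v]
    rw [map_sum]
  rw [hdec, Finset.sum_apply]
  -- per-bond bounds, with locality built into `kerQdd`
  have hM : ∀ s : S, ‖f (Pi.single s (v s)) c‖ ≤ m * (kerQdd L j c.1.1 c.1.2 s.1.1 s.1.2 * ‖v s‖) := fun s => by
    rw [hf, ← mul_assoc]
    exact norm_fderiv_covAvgMap_cplx_single_le L hL hG k U₀ hU₀ hα hα3 hα8 h52 B' hb' hB' hsmall' hc₃' hb'1 hE hdX hρ hsmall hc₃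
      hβ S T ha hj s (v s) c
  calc ‖∑ s, f (Pi.single s (v s)) c‖ ≤ ∑ s, ‖f (Pi.single s (v s)) c‖ := norm_sum_le _ _
    _ ≤ ∑ s : S, m * (kerQdd L j c.1.1 c.1.2 s.1.1 s.1.2 * ‖v s‖) := sum_le_sum fun s _ => hM s
    _ = m * ∑ s : S, kerQdd L j c.1.1 c.1.2 s.1.1 s.1.2 * ‖v s‖ := by rw [Finset.mul_sum]
    _ ≤ m * (2 * d * ‖v‖) := mul_le_mul_of_nonneg_left (sum_kerQdd_mul_norm_le S L hL1 j c.1.1 c.1.2 v) hm0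
    _ = 2 * d * (L : ℝ) ^ j
        * (1 + thetaCplx d L α₀ k b' * ((L : ℝ) ^ j * ((L : ℝ) ^ k)⁻¹) + C3Cplx d L * ((L : ℝ) ^ j * ρ)) * ‖v‖ := by
        rw [hm]; ring

/-! ### Real-scalar forms (the shape differentiated over `ℝ` in [Balaban1987RG1] (3.48)–(3.49)) -/

include hL hG hU₀ hα hα3 hα8 h52 hb' hB' hsmall' hc₃' hb'1 hρ hsmall hc₃ ha in
/-- `covAvgMap L (e^{B′}U₀) S T j` is real-differentiable on the polydisc (restriction of scalars). [cite: Balaban1985Averaging, Proposition 7 p.43] -/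
theorem differentiableAt_covAvgMap_cplx_real {j : ℕ} (hj : j ≤ k) :
    DifferentiableAt ℝ (covAvgMap L (expCfg B' * U₀) S T j) a :=
  (differentiableAt_covAvgMap_cplx L hL hG k U₀ hU₀ hα hα3 hα8 h52 B' hb' hB' hsmall' hc₃' hb'1 hρ hsmall hc₃ S T ha
    hj).restrictScalars ℝ

include hL hG hU₀ hα hα3 hα8 h52 hb' hB' hsmall' hc₃' hb'1 hρ hsmall hc₃ ha in
/-- The real Fréchet derivative of `covAvgMap L (e^{B′}U₀) S T j` is the complex one with scalars restricted: same values.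
[cite: Balaban1985Averaging, (137)–(138) p.39, Proposition 7 p.43] -/
theorem fderiv_real_covAvgMap_cplx_apply {j : ℕ} (hj : j ≤ k) (v : S → 𝔸) :
    fderiv ℝ (covAvgMap L (expCfg B' * U₀) S T j) a v = fderiv ℂ (covAvgMap L (expCfg B' * U₀) S T j) a v := by
  rw [((differentiableAt_covAvgMap_cplx L hL hG k U₀ hU₀ hα hα3 hα8 h52 B' hb' hB' hsmall' hc₃' hb'1 hρ hsmall hc₃ S T ha
    hj).hasFDerivAt.restrictScalars ℝ).fderiv]
  rfl

include hL hG hU₀ hα hα3 hα8 h52 hb' hB' hsmall' hc₃' hb'1 hE hdX hρ hsmall hc₃ hβ ha in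
/-- **PROPOSITION 5 AT `U′U₀`, OPERATOR FORM over `ℝ`, UNIFORMLY IN `U′`**: `‖D_ℝ Q_j(U′U₀, ·)(ins a)‖ ≤ 2dLʲ(1 + ϑLʲ/Lᵏ + C₃Lʲρ)` —
the hypothesis shape `‖fderiv ℝ Q y‖ ≤ C·Lʲ` of `B12QPrime348.ineq349_lam330` for `Q = covAvgMap L (e^{B′}U₀) S T j`, with `C = 2d(1 +
ϑ + C₃Lᵏρ)` k-uniformly and independently of `U′`. [cite: Balaban1985Averaging, Prop. 5 (156) p.42, (150) p.40, Proposition 7 p.43] -/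
theorem opNorm_fderiv_real_covAvgMap_cplx_le {j : ℕ} (hj : j ≤ k) :
    ‖fderiv ℝ (covAvgMap L (expCfg B' * U₀) S T j) a‖ ≤
      2 * d * (L : ℝ) ^ j
        * (1 + thetaCplx d L α₀ k b' * ((L : ℝ) ^ j * ((L : ℝ) ^ k)⁻¹) + C3Cplx d L * ((L : ℝ) ^ j * ρ)) := by
  rw [((differentiableAt_covAvgMap_cplx L hL hG k U₀ hU₀ hα hα3 hα8 h52 B' hb' hB' hsmall' hc₃' hb'1 hρ hsmall hc₃ S T ha
    hj).hasFDerivAt.restrictScalars ℝ).fderiv, ContinuousLinearMap.norm_restrictScalars]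
  exact opNorm_fderiv_covAvgMap_cplx_le L hL hG k U₀ hU₀ hα hα3 hα8 h52 B' hb' hB' hsmall' hc₃' hb'1 hE hdX hρ hsmall hc₃ hβ S T
    ha hj

include hL hG hU₀ hα hα3 hα8 h52 hb' hB' hsmall' hc₃' hb'1 hE hdX hρ hsmall hc₃ hβ ha in
/-- **The per-bond data over `ℝ` at `U′U₀`**: on the polydisc the real partial derivative in the variable `s` satisfies `‖∂_s(c)·X‖ ≤
((1 + ϑLʲ/Lᵏ)Lʲ + C₃(Lʲ)²ρ)·kerQdd(c, s)·‖X‖` (so it vanishes unless `s ⊂ box(c)`).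
[cite: Balaban1985Averaging, Prop. 5 (156) p.42, (141) p.39, Proposition 7 p.43] -/
theorem fderiv_real_covAvgMap_cplx_single_bound {j : ℕ} (hj : j ≤ k) (s : S) (X : 𝔸) (c : T) :
    ‖fderiv ℝ (covAvgMap L (expCfg B' * U₀) S T j) a (Pi.single s X) c‖ ≤
      ((1 + thetaCplx d L α₀ k b' * ((L : ℝ) ^ j * ((L : ℝ) ^ k)⁻¹)) * (L : ℝ) ^ j + C3Cplx d L * ((L : ℝ) ^ j) ^ 2 * ρ)
        * kerQdd L j c.1.1 c.1.2 s.1.1 s.1.2 * ‖X‖ ∧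
      (¬ BondIn (loK L j c.1.1) (bondHiK L j c.1.1 c.1.2) s.1.1 s.1.2 →
        fderiv ℝ (covAvgMap L (expCfg B' * U₀) S T j) a (Pi.single s X) c = 0) := by
  rw [fderiv_real_covAvgMap_cplx_apply L hL hG k U₀ hU₀ hα hα3 hα8 h52 B' hb' hB' hsmall' hc₃' hb'1 hρ hsmall hc₃ S T ha hj]
  exact ⟨norm_fderiv_covAvgMap_cplx_single_le L hL hG k U₀ hU₀ hα hα3 hα8 h52 B' hb' hB' hsmall' hc₃' hb'1 hE hdX hρ hsmall hc₃
      hβ S T ha hj s X c,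
    fun hnot => fderiv_covAvgMap_cplx_single_eq_zero L hL hG k U₀ hU₀ hα hα3 hα8 h52 B' hb' hB' hsmall' hc₃' hb'1 hE hdX hρ
      hsmall hc₃ hβ S T ha hj s X c hnot⟩

end Regime

end Literature.MathematicalPhysics.QuantumFieldTheory.Balaban1983to89.B7Prop5CplxOperator
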